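import Summits.QuantumFields.YangMills.Theorems.BalabanUVNodesN15KingModelGraphTreeDecayProp36
import Summits.QuantumFields.YangMills.Theorems.BalabanUVNodesN15KingModelGraphTreeDecaySize
import Summits.QuantumFields.YangMills.Theorems.BalabanUVNodesN15KingModelGraphPowerCountingSubgraphsKing

/-!
# BalabanUVNodes ∕ N15 — THE KING-MODEL RUNG (PART Α-f): (3.56) WITH ITS TREE DECAY IN KING's OWN HYPOTHESES — the certificates of part Α-e discharged by
# Kruskal's tree lines (part Γ-l), (3.77) verbatim with the margin free (part Δ-b), p. 664's «every subgraph has positive degree» verbatim (part Δ-b), and the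
# two-point reading: the η-difference of a connected graph decays exponentially in the separation of any two of its external points
# (Track A, DAG node N15 = NE2; FAN-OUT v1.1 §N15 s3 «KING-MODEL RUNG … NE2's analogue DECIDED in the model»)

HONEST FRAMING.  Count-neutral (cell `pub-ymgap`, seat `pub-ymgap-dag-n15-e` g29; `--supports stmt-QuantumFields-27366 --as helper` = K3⁸
`SpineGivenEndpointR13SepCoPHV`).  TEMPLATE LITERATURE: C. King, *The U(1) Higgs model. I. The continuum limit*, Commun. Math. Phys. **102** (1986) 649–677
[King1986], Proposition 3.6 (3.56) p. 662, its hypothesis p. 664 ∕ (3.77) p. 666, the tree distance p. 660 — for KING's OWN `A = 0` MODEL on the rung's tori.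
NOT Bałaban's non-abelian `G(U)` of [B9]; NOT a node discharge; nothing continuum ∕ ℝ⁴ ∕ OS ∕ mass-gap ∕ Clay.  0 `sorry`; standard axioms.  Text layer of
pp. 660–666 (`paper:king1986-cmp102-king-u1-higgs-i` p0012–p0018) re-read by this seat 2026-08-29.

THE PRINT.  p. 662 [PDF 14] (3.56): the right-hand side carries *«L^{−γk}»* and *«exp[−δ d(…, {y_i}, {z_q}, {w_l})]»*; p. 660 [PDF 12]: *«the length of the
shortest tree graph connecting {u_i}»*; p. 664 [PDF 16]: *«renormalised graphs, in which every subgraph has positive degree»*; p. 666 [PDF 18] (3.77):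
*«D(H_i) > 0 for 1 ≤ i ≤ m₁»*.

WHAT THIS FILE PROVES (namespace `Summit.QuantumFields.YangMills.BalabanUVNodes.N15KingModelRung.Curved`).
* `kingDist_symm`∕`kingDist_self`∕`kingDist_triangle` (the unit-block distance is a pseudometric), ★ `kingDist_le_treeLength_anchors` (two anchored points are
  at most the anchors' tree length apart), ★ `exp_treeLength_le_exp_pair` (`exp[−δ·treeLength] ≤ exp[−δ|y₁ − y₂|]`, `δ ≥ 0`).
* ★★★ **`king_prop36_graph_zeroField_treeDecay_kruskal`** — part Α-e's theorem with the certificates DISCHARGED (Kruskal's tree lines per ordering, part Γ-l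
  `exists_certR_kruskal`): the hypothesis is King's (3.77) with a margin, `∀ π, PosDegreesBy γ₁ (kingDegList …)`.
* ★★★ **`king_prop36_graph_zeroField_treeDecay_377`** — (3.77) VERBATIM (`PosDegrees`, no margin; `γ₁ = ½` by integrality, part Δ-b).
* ★★★ **`king_prop36_graph_zeroField_treeDecay_subgraphs`** — p. 664 VERBATIM: `PosSubgraphsBy src tgt 0 (d+1) (lineExp ∘ κ)` (every non-empty connected
  sub-line-set has positive degree) ⇒ (3.56) WITH ITS TREE DECAY, rate `L^{−min(γ₀, ¼)K}`, decay `exp[−min(δ₁, δ′)·treeLength({y_υ})]`.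
* ★★★ **`king_graph_size_treeDecay_kruskal`** — THEOREM 3.5 (i) (3.38)'s SHAPE: the SIZE of a connected graph with King's full `A = 0` propagators and
  anchored one-vertex factors, under (3.77) with a margin-free `PosDegrees (kingDegList …)`, is `≤ exp[−min(δ₁, δ′)·treeLength{y_υ}]·Γ·C₁^m·C₂^{nn}·(Σ_π degConst
  (kingDegList …))·Π qq` — part Α-k `king_graph_size_decay_R` with part Α-b's `Θ₀` and Kruskal's certificates.

HONEST SCOPE.  (a) As part Α-e: King's `A = 0` model, `G`∕`∂G` lines, anchored one-vertex factors with user-supplied decay `δ′` (external lines: Thm 3.3 ∕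
Prop. 3.8, not instantiated here); §3.5∕Thm 3.5 (which graphs are renormalised so that the subgraph condition holds) NOT typed — parts Δ-d…Δ-j decide the
condition for explicit `G`∕`∂G` graphs.  (b) `treeLength` minimises over connecting edge sets (King's tree minimum by pruning, not typed).  (c) NOT Bałaban's
`G(U)`; NE2 ∕ N15 untouched; counts unmoved.  Locators: [King1986] Prop. 3.6 (3.56) p.662, p.660, p.664, (3.66) p.663, (3.77) p.666.
-/

noncomputable section

namespace Summit.QuantumFields.YangMills.BalabanUVNodes.N15KingModelRung.Curved

open scoped BigOperators
open Finset
open Literature.MathematicalPhysics.QuantumFieldTheory.Balaban1983to89.B5Prop11Plancherel (Tor fine)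
open Literature.MathematicalPhysics.QuantumFieldTheory.King1986.Torus (tdistT tdistT_nonneg tdistT_symm tdistT_self tdistT_triangle)
open Summit.QuantumFields.YangMills.BalabanUVNodes.N15KingModelRung (KingVolIndex kingVol kingVol_neZero)
open Summit.QuantumFields.YangMills.BalabanUVNodes.N15KingModelRung.Graph

variable {d : ℕ} (L : ℕ) [NeZero L]

/-! ## §1 The unit-block distance is a pseudometric; two anchored points and the tree length -/

section Dist

variable (jv : KingVolIndex d)

/-- symmetry. [folklore] -/
theorem kingDist_symm (x y : haveI := kingVol_neZero L jv; Tor (fine (L ^ jv.K) (kingVol L jv))) : kingDist L jv x y = kingDist L jv y x := by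
  haveI := kingVol_neZero L jv
  unfold kingDist; rw [tdistT_symm]

/-- `|x − x| = 0`. [folklore] -/
theorem kingDist_self (x : haveI := kingVol_neZero L jv; Tor (fine (L ^ jv.K) (kingVol L jv))) : kingDist L jv x x = 0 := by
  haveI := kingVol_neZero L jv
  unfold kingDist; rw [tdistT_self, zero_div]

/-- triangle inequality. [folklore] -/
theorem kingDist_triangle (x y z : haveI := kingVol_neZero L jv; Tor (fine (L ^ jv.K) (kingVol L jv))) :
    kingDist L jv x z ≤ kingDist L jv x y + kingDist L jv y z := by
  haveI := kingVol_neZero L jv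
  unfold kingDist
  rw [← add_div]
  exact div_le_div_of_nonneg_right (tdistT_triangle _ x y z) (pow_nonneg (Nat.cast_nonneg L) _)

/-- ★ **TWO ANCHORED EXTERNAL POINTS ARE AT MOST THE ANCHORS' TREE LENGTH APART**: if `υ₁`, `υ₂` are anchored at `y₁`, `y₂`, then
`|y₁ − y₂| ≤ treeLength |·| (anchors anch)` (part Α-b `le_treeLength`). [cite: King1986, p.660 («the length of the shortest tree graph connecting {u_i}»)] -/
theorem kingDist_le_treeLength_anchors {Υ : Type*} [Fintype Υ]
    (anch : Υ → Option (haveI := kingVol_neZero L jv; Tor (fine (L ^ jv.K) (kingVol L jv)))) {υ₁ υ₂ : Υ}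
    {y₁ y₂ : haveI := kingVol_neZero L jv; Tor (fine (L ^ jv.K) (kingVol L jv))} (h₁ : anch υ₁ = some y₁) (h₂ : anch υ₂ = some y₂) :
    haveI := kingVol_neZero L jv
    kingDist L jv y₁ y₂ ≤ treeLength (kingDist L jv) (anchors anch) := by
  haveI := kingVol_neZero L jv
  exact le_treeLength (kingDist_nonneg L jv) (kingDist_self L jv) (kingDist_symm L jv) (kingDist_triangle L jv)
    ((mem_anchors anch).2 ⟨υ₁, h₁⟩) ((mem_anchors anch).2 ⟨υ₂, h₂⟩)

/-- ★ **THE TREE DECAY DOMINATES THE TWO-POINT DECAY**: `exp[−δ·treeLength] ≤ exp[−δ|y₁ − y₂|]` for anchored `y₁, y₂` and `δ ≥ 0` — the η-difference of a connected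
graph with two external legs decays exponentially in their separation. [cite: King1986, Prop. 3.6 (3.56) p.662, p.660] -/
theorem exp_treeLength_le_exp_pair {Υ : Type*} [Fintype Υ]
    (anch : Υ → Option (haveI := kingVol_neZero L jv; Tor (fine (L ^ jv.K) (kingVol L jv)))) {υ₁ υ₂ : Υ}
    {y₁ y₂ : haveI := kingVol_neZero L jv; Tor (fine (L ^ jv.K) (kingVol L jv))} (h₁ : anch υ₁ = some y₁) (h₂ : anch υ₂ = some y₂) {δ : ℝ} (hδ : 0 ≤ δ) :
    haveI := kingVol_neZero L jv
    Real.exp (-(δ * treeLength (kingDist L jv) (anchors anch))) ≤ Real.exp (-(δ * kingDist L jv y₁ y₂)) :=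
  Real.exp_le_exp.2 (neg_le_neg (mul_le_mul_of_nonneg_left (kingDist_le_treeLength_anchors L jv anch h₁ h₂) hδ))

end Dist

/-! ## §2 (3.56) with its tree decay: certificates discharged, (3.77) verbatim, p. 664 verbatim -/

section Kruskal

/-- ★★★ **KING 1986 PROPOSITION 3.6 (3.56) WITH ITS EXPONENTIAL TREE DECAY, FOR CONNECTED GRAPHS IN KING's OWN HYPOTHESIS (3.77) WITH A MARGIN, BY NAME AT
`A = 0`**: part Α-e's theorem with the certificates DISCHARGED — along every ordering Kruskal's tree lines (King's «reaches a new point») give the certificate,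
and the hypothesis is `∀ π, PosDegreesBy γ₁ (kingDegList …)`; same constants and bound `exp[−min(δ₁, δ′)·treeLength]·(…)`.
[cite: King1986, Prop. 3.6 (3.56) p.662, (3.66) p.663, (3.77) p.666, p.660, p.664] -/
theorem king_prop36_graph_zeroField_treeDecay_kruskal (hLodd : Odd L) (hL : 2 ≤ L) {a : ℝ} (ha : 0 < a) {m0sq : ℝ} (hm0 : 0 ≤ m0sq) :
    ∃ C₁ C₂ γ₀ δ₁ : ℝ, 0 < C₁ ∧ 0 < C₂ ∧ 0 < γ₀ ∧ 0 < δ₁ ∧ ∀ (msq : ℝ), 0 < msq → msq ≤ m0sq → ∀ (jv : KingVolIndex d) (n : ℕ), 1 ≤ n →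
      ∀ (nn m : ℕ) (src tgt : Fin m → Fin (nn + 1)), (∀ v, LConn src tgt univ 0 v) →
      ∀ (κ : Fin m → Option (Fin (d + 1))) (Υ : Type) [Fintype Υ] [DecidableEq Υ]
        (vtx : Υ → Fin (nn + 1)) (υ₀ : Υ), vtx υ₀ = 0 →
        haveI := kingVol_neZero L jv
        ∀ (anch : Υ → Option (Tor (fine (L ^ jv.K) (kingVol L jv)))) (δ' : ℝ), 0 ≤ δ' →
        ∀ (u : Υ → Tor (fine (L ^ jv.K) (kingVol L jv)) → ℝ) (u' : Υ → Tor (fine (L ^ (jv.K + n)) (kingVol L jv)) → ℝ)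
          (qq s : Υ → ℝ) (p₀ r₀ : Tor (fine (L ^ jv.K) (kingVol L jv)) → ℝ) (Γ Γ' γ₁ : ℝ),
          (∀ υ, 0 ≤ qq υ) → (∀ υ, 0 ≤ s υ) → (∀ x, 0 ≤ p₀ x) → (∀ x, 0 ≤ r₀ x) →
          (∀ υ, υ ≠ υ₀ → ∀ x, |u υ x| ≤ qq υ * legWeight δ' (kingDist L jv) (anch υ) x) →
          (∀ υ, υ ≠ υ₀ → ∀ x', |u' υ x'| ≤ qq υ * legWeight δ' (kingDist L jv) (anch υ) (kingSlicePt L jv.K n (kingVol L jv) x')) →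
          (∀ υ, υ ≠ υ₀ → ∀ x', |u' υ x' - u υ (kingSlicePt L jv.K n (kingVol L jv) x')|
              ≤ s υ * qq υ * legWeight δ' (kingDist L jv) (anch υ) (kingSlicePt L jv.K n (kingVol L jv) x')) →
          (∀ x, |u υ₀ x| ≤ p₀ x * legWeight δ' (kingDist L jv) (anch υ₀) x) →
          (∀ x', |u' υ₀ x'| ≤ p₀ (kingSlicePt L jv.K n (kingVol L jv) x') * legWeight δ' (kingDist L jv) (anch υ₀) (kingSlicePt L jv.K n (kingVol L jv) x')) →
          (∀ x', |u' υ₀ x' - u υ₀ (kingSlicePt L jv.K n (kingVol L jv) x')|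
              ≤ r₀ (kingSlicePt L jv.K n (kingVol L jv) x') * legWeight δ' (kingDist L jv) (anch υ₀) (kingSlicePt L jv.K n (kingVol L jv) x')) →
          (∑ x, (((L : ℝ) ^ jv.K)⁻¹) ^ (d + 1) * p₀ x ≤ Γ) → (∑ x, (((L : ℝ) ^ jv.K)⁻¹) ^ (d + 1) * r₀ x ≤ Γ') → 0 < γ₁ →
          (∀ π : Equiv.Perm (Fin m), PosDegreesBy γ₁ (kingDegList src tgt ((d + 1 : ℕ) : ℝ) (fun ℓ => lineExp (d + 1) (κ ℓ)) π)) →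
            |graphValLS ((((L : ℝ) ^ (jv.K + n))⁻¹) ^ (d + 1)) src tgt (fun ℓ => kingGLine L (kingVol L jv) a msq (jv.K + n) (κ ℓ)) vtx u'
                - graphValLS ((((L : ℝ) ^ jv.K)⁻¹) ^ (d + 1)) src tgt (fun ℓ => kingGLine L (kingVol L jv) a msq jv.K (κ ℓ)) vtx u|
              ≤ Real.exp (-(min δ₁ δ' * treeLength (kingDist L jv) (anchors anch)))
                * ((Γ' + Γ * ((L : ℝ) ^ (-(min γ₀ (γ₁ / 2) * jv.K)) * (m + 1) + ∑ υ ∈ univ.erase υ₀, s υ))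
                  * (C₁ ^ m * C₂ ^ nn * ((m.factorial : ℝ) * ((1 - (L : ℝ) ^ (-(γ₁ / 2)))⁻¹) ^ m) * ∏ υ ∈ univ.erase υ₀, qq υ)) := by
  obtain ⟨C₁, C₂, γ₀, δ₁, hC₁, hC₂, hγ₀, hδ₁, H⟩ := king_prop36_graph_zeroField_treeDecay_R (d := d) L hLodd hL ha hm0
  refine ⟨C₁, C₂, γ₀, δ₁, hC₁, hC₂, hγ₀, hδ₁, fun msq hm hcap jv n hn nn m src tgt hconn κ Υ _ _ vtx υ₀ hυ₀ anch δ' hδ' u u' qq s p₀ r₀ Γ Γ' γ₁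
    hqq hs hp₀0 hr₀ hu hu' hus hp₀ hp₀' hr₀' hΓ hΓ' hγ₁ hking => ?_⟩
  -- Kruskal's certificates, one per ordering
  have hex := fun π : Equiv.Perm (Fin m) => exists_certR_kruskal hconn π
  refine H msq hm hcap jv n hn nn m src tgt hconn κ Υ vtx υ₀ hυ₀ anch δ' hδ' u u' qq s p₀ r₀ Γ Γ' γ₁ hqq hs hp₀0 hr₀ hu hu' hus hp₀ hp₀' hr₀' hΓ hΓ' hγ₁
    (fun π => Classical.choose (hex π)) fun π => ?_
  rw [orderList_eq_kingDegList _ _ π _ (Classical.choose_spec (hex π))]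
  exact hking π

/-- ★★★ **… IN KING's OWN HYPOTHESIS (3.77) VERBATIM — NO MARGIN** (the margin `½` is free by integrality, part Δ-b `posDegreesBy_half_kingDegList`): rate
`L^{−min(γ₀, ¼)K}`, orderings constant `m!·((1 − L^{−¼})^{−1})^m`, decay `exp[−min(δ₁, δ′)·treeLength]`. [cite: King1986, Prop. 3.6 (3.56) p.662, (3.77) p.666,
p.665 («for γ small enough»), p.660] -/
theorem king_prop36_graph_zeroField_treeDecay_377 (hLodd : Odd L) (hL : 2 ≤ L) {a : ℝ} (ha : 0 < a) {m0sq : ℝ} (hm0 : 0 ≤ m0sq) :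
    ∃ C₁ C₂ γ₀ δ₁ : ℝ, 0 < C₁ ∧ 0 < C₂ ∧ 0 < γ₀ ∧ 0 < δ₁ ∧ ∀ (msq : ℝ), 0 < msq → msq ≤ m0sq → ∀ (jv : KingVolIndex d) (n : ℕ), 1 ≤ n →
      ∀ (nn m : ℕ) (src tgt : Fin m → Fin (nn + 1)), (∀ v, LConn src tgt univ 0 v) →
      ∀ (κ : Fin m → Option (Fin (d + 1))) (Υ : Type) [Fintype Υ] [DecidableEq Υ]
        (vtx : Υ → Fin (nn + 1)) (υ₀ : Υ), vtx υ₀ = 0 →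
        haveI := kingVol_neZero L jv
        ∀ (anch : Υ → Option (Tor (fine (L ^ jv.K) (kingVol L jv)))) (δ' : ℝ), 0 ≤ δ' →
        ∀ (u : Υ → Tor (fine (L ^ jv.K) (kingVol L jv)) → ℝ) (u' : Υ → Tor (fine (L ^ (jv.K + n)) (kingVol L jv)) → ℝ)
          (qq s : Υ → ℝ) (p₀ r₀ : Tor (fine (L ^ jv.K) (kingVol L jv)) → ℝ) (Γ Γ' : ℝ),
          (∀ υ, 0 ≤ qq υ) → (∀ υ, 0 ≤ s υ) → (∀ x, 0 ≤ p₀ x) → (∀ x, 0 ≤ r₀ x) →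
          (∀ υ, υ ≠ υ₀ → ∀ x, |u υ x| ≤ qq υ * legWeight δ' (kingDist L jv) (anch υ) x) →
          (∀ υ, υ ≠ υ₀ → ∀ x', |u' υ x'| ≤ qq υ * legWeight δ' (kingDist L jv) (anch υ) (kingSlicePt L jv.K n (kingVol L jv) x')) →
          (∀ υ, υ ≠ υ₀ → ∀ x', |u' υ x' - u υ (kingSlicePt L jv.K n (kingVol L jv) x')|
              ≤ s υ * qq υ * legWeight δ' (kingDist L jv) (anch υ) (kingSlicePt L jv.K n (kingVol L jv) x')) →
          (∀ x, |u υ₀ x| ≤ p₀ x * legWeight δ' (kingDist L jv) (anch υ₀) x) →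
          (∀ x', |u' υ₀ x'| ≤ p₀ (kingSlicePt L jv.K n (kingVol L jv) x') * legWeight δ' (kingDist L jv) (anch υ₀) (kingSlicePt L jv.K n (kingVol L jv) x')) →
          (∀ x', |u' υ₀ x' - u υ₀ (kingSlicePt L jv.K n (kingVol L jv) x')|
              ≤ r₀ (kingSlicePt L jv.K n (kingVol L jv) x') * legWeight δ' (kingDist L jv) (anch υ₀) (kingSlicePt L jv.K n (kingVol L jv) x')) →
          (∑ x, (((L : ℝ) ^ jv.K)⁻¹) ^ (d + 1) * p₀ x ≤ Γ) → (∑ x, (((L : ℝ) ^ jv.K)⁻¹) ^ (d + 1) * r₀ x ≤ Γ') →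
          (∀ π : Equiv.Perm (Fin m), PosDegrees (kingDegList src tgt ((d + 1 : ℕ) : ℝ) (fun ℓ => lineExp (d + 1) (κ ℓ)) π)) →
            |graphValLS ((((L : ℝ) ^ (jv.K + n))⁻¹) ^ (d + 1)) src tgt (fun ℓ => kingGLine L (kingVol L jv) a msq (jv.K + n) (κ ℓ)) vtx u'
                - graphValLS ((((L : ℝ) ^ jv.K)⁻¹) ^ (d + 1)) src tgt (fun ℓ => kingGLine L (kingVol L jv) a msq jv.K (κ ℓ)) vtx u|
              ≤ Real.exp (-(min δ₁ δ' * treeLength (kingDist L jv) (anchors anch)))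
                * ((Γ' + Γ * ((L : ℝ) ^ (-(min γ₀ (1 / 4) * jv.K)) * (m + 1) + ∑ υ ∈ univ.erase υ₀, s υ))
                  * (C₁ ^ m * C₂ ^ nn * ((m.factorial : ℝ) * ((1 - (L : ℝ) ^ (-(1 / 4 : ℝ)))⁻¹) ^ m) * ∏ υ ∈ univ.erase υ₀, qq υ)) := by
  obtain ⟨C₁, C₂, γ₀, δ₁, hC₁, hC₂, hγ₀, hδ₁, H⟩ := king_prop36_graph_zeroField_treeDecay_kruskal (d := d) L hLodd hL ha hm0
  refine ⟨C₁, C₂, γ₀, δ₁, hC₁, hC₂, hγ₀, hδ₁, fun msq hm hcap jv n hn nn m src tgt hconn κ Υ _ _ vtx υ₀ hυ₀ anch δ' hδ' u u' qq s p₀ r₀ Γ Γ'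
    hqq hs hp₀0 hr₀ hu hu' hus hp₀ hp₀' hr₀' hΓ hΓ' h377 => ?_⟩
  have key := H msq hm hcap jv n hn nn m src tgt hconn κ Υ vtx υ₀ hυ₀ anch δ' hδ' u u' qq s p₀ r₀ Γ Γ' (1 / 2) hqq hs hp₀0 hr₀ hu hu' hus hp₀ hp₀' hr₀'
    hΓ hΓ' one_half_pos fun π => posDegreesBy_half_kingDegList (d + 1) κ π (h377 π)
  have e4 : (1 / 2 : ℝ) / 2 = 1 / 4 := by norm_num
  rw [e4] at key
  exact key

/-- ★★★ **KING 1986 PROPOSITION 3.6 (3.56) WITH ITS EXPONENTIAL TREE DECAY, FOR CONNECTED GRAPHS «IN WHICH EVERY SUBGRAPH HAS POSITIVE DEGREE» (p. 664,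
VERBATIM), BY NAME AT `A = 0`**: the hypothesis is ordering-free and without margin — `PosSubgraphsBy src tgt 0 (d+1) (lineExp ∘ κ)` (every non-empty connected
sub-line-set `S` has `(d+1)(|V(S)| − 1) + Σ_S e > 0`); then (3.77) holds along every ordering (part Δ-b) and the previous theorem applies:
`|E^{(K+n)}(H) − E^{(K)}(H)| ≤ exp[−min(δ₁, δ′)·treeLength |·| {y_υ}]·(Γ′ + Γ·(L^{−min(γ₀,¼)K}(m+1) + Σ s))·C₁^m·C₂^{nn}·(m!·(1 − L^{−¼})^{−m})·Π qq` — THE RATE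
`L^{−γk}` AND THE TREE DECAY OF (3.56), BOTH, for every connected `G`∕`∂G` graph satisfying p. 664's sentence (decidable per graph: parts Δ-d…Δ-j).
[cite: King1986, Prop. 3.6 (3.56) p.662, p.664 («every subgraph has positive degree»; «By extracting a small part of each propagator …»), p.660, (3.77) p.666] -/
theorem king_prop36_graph_zeroField_treeDecay_subgraphs (hLodd : Odd L) (hL : 2 ≤ L) {a : ℝ} (ha : 0 < a) {m0sq : ℝ} (hm0 : 0 ≤ m0sq) :
    ∃ C₁ C₂ γ₀ δ₁ : ℝ, 0 < C₁ ∧ 0 < C₂ ∧ 0 < γ₀ ∧ 0 < δ₁ ∧ ∀ (msq : ℝ), 0 < msq → msq ≤ m0sq → ∀ (jv : KingVolIndex d) (n : ℕ), 1 ≤ n →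
      ∀ (nn m : ℕ) (src tgt : Fin m → Fin (nn + 1)), (∀ v, LConn src tgt univ 0 v) →
      ∀ (κ : Fin m → Option (Fin (d + 1))), PosSubgraphsBy src tgt 0 ((d + 1 : ℕ) : ℝ) (fun ℓ => lineExp (d + 1) (κ ℓ)) →
      ∀ (Υ : Type) [Fintype Υ] [DecidableEq Υ]
        (vtx : Υ → Fin (nn + 1)) (υ₀ : Υ), vtx υ₀ = 0 →
        haveI := kingVol_neZero L jv
        ∀ (anch : Υ → Option (Tor (fine (L ^ jv.K) (kingVol L jv)))) (δ' : ℝ), 0 ≤ δ' →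
        ∀ (u : Υ → Tor (fine (L ^ jv.K) (kingVol L jv)) → ℝ) (u' : Υ → Tor (fine (L ^ (jv.K + n)) (kingVol L jv)) → ℝ)
          (qq s : Υ → ℝ) (p₀ r₀ : Tor (fine (L ^ jv.K) (kingVol L jv)) → ℝ) (Γ Γ' : ℝ),
          (∀ υ, 0 ≤ qq υ) → (∀ υ, 0 ≤ s υ) → (∀ x, 0 ≤ p₀ x) → (∀ x, 0 ≤ r₀ x) →
          (∀ υ, υ ≠ υ₀ → ∀ x, |u υ x| ≤ qq υ * legWeight δ' (kingDist L jv) (anch υ) x) →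
          (∀ υ, υ ≠ υ₀ → ∀ x', |u' υ x'| ≤ qq υ * legWeight δ' (kingDist L jv) (anch υ) (kingSlicePt L jv.K n (kingVol L jv) x')) →
          (∀ υ, υ ≠ υ₀ → ∀ x', |u' υ x' - u υ (kingSlicePt L jv.K n (kingVol L jv) x')|
              ≤ s υ * qq υ * legWeight δ' (kingDist L jv) (anch υ) (kingSlicePt L jv.K n (kingVol L jv) x')) →
          (∀ x, |u υ₀ x| ≤ p₀ x * legWeight δ' (kingDist L jv) (anch υ₀) x) →
          (∀ x', |u' υ₀ x'| ≤ p₀ (kingSlicePt L jv.K n (kingVol L jv) x') * legWeight δ' (kingDist L jv) (anch υ₀) (kingSlicePt L jv.K n (kingVol L jv) x')) →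
          (∀ x', |u' υ₀ x' - u υ₀ (kingSlicePt L jv.K n (kingVol L jv) x')|
              ≤ r₀ (kingSlicePt L jv.K n (kingVol L jv) x') * legWeight δ' (kingDist L jv) (anch υ₀) (kingSlicePt L jv.K n (kingVol L jv) x')) →
          (∑ x, (((L : ℝ) ^ jv.K)⁻¹) ^ (d + 1) * p₀ x ≤ Γ) → (∑ x, (((L : ℝ) ^ jv.K)⁻¹) ^ (d + 1) * r₀ x ≤ Γ') →
            |graphValLS ((((L : ℝ) ^ (jv.K + n))⁻¹) ^ (d + 1)) src tgt (fun ℓ => kingGLine L (kingVol L jv) a msq (jv.K + n) (κ ℓ)) vtx u'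
                - graphValLS ((((L : ℝ) ^ jv.K)⁻¹) ^ (d + 1)) src tgt (fun ℓ => kingGLine L (kingVol L jv) a msq jv.K (κ ℓ)) vtx u|
              ≤ Real.exp (-(min δ₁ δ' * treeLength (kingDist L jv) (anchors anch)))
                * ((Γ' + Γ * ((L : ℝ) ^ (-(min γ₀ (1 / 4) * jv.K)) * (m + 1) + ∑ υ ∈ univ.erase υ₀, s υ))
                  * (C₁ ^ m * C₂ ^ nn * ((m.factorial : ℝ) * ((1 - (L : ℝ) ^ (-(1 / 4 : ℝ)))⁻¹) ^ m) * ∏ υ ∈ univ.erase υ₀, qq υ)) := by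
  obtain ⟨C₁, C₂, γ₀, δ₁, hC₁, hC₂, hγ₀, hδ₁, H⟩ := king_prop36_graph_zeroField_treeDecay_377 (d := d) L hLodd hL ha hm0
  refine ⟨C₁, C₂, γ₀, δ₁, hC₁, hC₂, hγ₀, hδ₁, fun msq hm hcap jv n hn nn m src tgt hconn κ hsub Υ _ _ vtx υ₀ hυ₀ anch δ' hδ' u u' qq s p₀ r₀ Γ Γ'
    hqq hs hp₀0 hr₀ hu hu' hus hp₀ hp₀' hr₀' hΓ hΓ' => ?_⟩
  exact H msq hm hcap jv n hn nn m src tgt hconn κ Υ vtx υ₀ hυ₀ anch δ' hδ' u u' qq s p₀ r₀ Γ Γ' hqq hs hp₀0 hr₀ hu hu' hus hp₀ hp₀' hr₀' hΓ hΓ'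
    fun π => posDegrees_of_posDegreesBy le_rfl (posDegreesBy_kingDegList_of_posSubgraphsBy le_rfl hsub π)

/-- ★★★ **THEOREM 3.5 (i) (3.38)'s SHAPE — THE SIZE OF A CONNECTED GRAPH DECAYS IN THE TREE LENGTH OF ITS EXTERNAL POINTS, BY NAME AT `A = 0`**: for odd
`L ≥ 3`, `a > 0`, `m₀² ≥ 0` there are `C₁, C₂, δ₁ > 0` such that for every `k ≥ 1`, cube `2L^{e_M}`, mass `0 < m² ≤ m₀²`, every CONNECTED numbered graph with King's
full `A = 0` propagators on its lines, anchors `anch`, leg rate `δ′ ≥ 0`, one-vertex factors `|u_υ(x)| ≤ qq_υ·legWeight δ′ (x)` (`υ ≠ υ₀`), `|u_{υ₀}(x)| ≤ p₀(x)·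
legWeight δ′ (x)` with `Σ_x η^{d+1}p₀ ≤ Γ`, and King's degrees positive along every ordering ((3.77), margin-free `PosDegrees (kingDegList …)`):
`|E^{(k)}(H)| ≤ exp[−min(δ₁, δ′)·treeLength |·| {y_υ}]·Γ·C₁^m·C₂^{nn}·(Σ_π degConst L (kingDegList …))·Π_{υ≠υ₀} qq_υ`, `|x − y| = tdistT∕L^k` — part Α-k
`king_graph_size_decay_R` with the weights `e^{−δ⋆|x−y|}`∕`legWeight δ⋆`, `Θ₀ = exp[−δ⋆·treeLength]` (part Α-b) and Kruskal's certificates (part Γ-l).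
[cite: King1986, Thm 3.5 (3.38) p.660, p.664 («extracting a small part of each propagator»), (3.66) p.663, (3.77) p.666] -/
theorem king_graph_size_treeDecay_kruskal (hLodd : Odd L) (hL : 2 ≤ L) {a : ℝ} (ha : 0 < a) {m0sq : ℝ} (hm0 : 0 ≤ m0sq) :
    ∃ C₁ C₂ δ₁ : ℝ, 0 < C₁ ∧ 0 < C₂ ∧ 0 < δ₁ ∧ ∀ (k eM : ℕ) (hk : 1 ≤ k) (M : Fin (d + 1) → ℕ) [∀ μ, NeZero (M μ)] (hM : ∀ μ, M μ = 2 * L ^ eM)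
      (msq : ℝ), 0 < msq → msq ≤ m0sq →
      ∀ (nn m : ℕ) (src tgt : Fin m → Fin (nn + 1)), (∀ v, LConn src tgt univ 0 v) → ∀ (κ : Fin m → Option (Fin (d + 1)))
        (Υ : Type) [Fintype Υ] [DecidableEq Υ] (vtx : Υ → Fin (nn + 1)) (υ₀ : Υ), vtx υ₀ = 0 →
        ∀ (anch : Υ → Option (Tor (fine (L ^ k) M))) (δ' : ℝ), 0 ≤ δ' →
        ∀ (u : Υ → Tor (fine (L ^ k) M) → ℝ) (qq : Υ → ℝ) (p₀ : Tor (fine (L ^ k) M) → ℝ) (Γ : ℝ),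
          (∀ υ, 0 ≤ qq υ) → (∀ x, 0 ≤ p₀ x) →
          (∀ υ, υ ≠ υ₀ → ∀ x, |u υ x| ≤ qq υ * legWeight δ' (fun x y => tdistT (fine (L ^ k) M) x y / (L : ℝ) ^ k) (anch υ) x) →
          (∀ x, |u υ₀ x| ≤ p₀ x * legWeight δ' (fun x y => tdistT (fine (L ^ k) M) x y / (L : ℝ) ^ k) (anch υ₀) x) →
          (∑ x, (((L : ℝ) ^ k)⁻¹) ^ (d + 1) * p₀ x ≤ Γ) →
          (∀ π : Equiv.Perm (Fin m), PosDegrees (kingDegList src tgt ((d + 1 : ℕ) : ℝ) (fun ℓ => lineExp (d + 1) (κ ℓ)) π)) →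
          |graphValLS ((((L : ℝ) ^ k)⁻¹) ^ (d + 1)) src tgt (fun ℓ => kingGLine L M a msq k (κ ℓ)) vtx u|
            ≤ Real.exp (-(min δ₁ δ' * treeLength (fun x y => tdistT (fine (L ^ k) M) x y / (L : ℝ) ^ k) (anchors anch)))
              * (Γ * (C₁ ^ m * C₂ ^ nn
                * (∑ π : Equiv.Perm (Fin m), degConst L (kingDegList src tgt ((d + 1 : ℕ) : ℝ) (fun ℓ => lineExp (d + 1) (κ ℓ)) π))
                * ∏ υ ∈ univ.erase υ₀, qq υ)) := by
  classical
  obtain ⟨C₁, C₂, δ₁, hC₁, hC₂, hδ₁, H⟩ := king_graph_size_decay_R (d := d) L hLodd hL ha hm0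
  refine ⟨C₁, C₂, δ₁, hC₁, hC₂, hδ₁, fun k eM hk M _ hM msq hm hcap nn m src tgt hconn κ Υ _ _ vtx υ₀ hυ₀ anch δ' hδ' u qq p₀ Γ hqq hp₀0 hu hp₀ hΓ hking => ?_⟩
  set ρ : Tor (fine (L ^ k) M) → Tor (fine (L ^ k) M) → ℝ := fun x y => tdistT (fine (L ^ k) M) x y / (L : ℝ) ^ k with hρ
  have hρ0 : ∀ x y, 0 ≤ ρ x y := fun x y => div_nonneg (tdistT_nonneg _ x y) (pow_nonneg (Nat.cast_nonneg L) _)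
  set δs : ℝ := min δ₁ δ' with hδs
  have hδs0 : 0 ≤ δs := le_min hδ₁.le hδ'
  -- the weights and their bound at every placement (part Α-b)
  set ϑ : Υ → Tor (fine (L ^ k) M) → ℝ := fun υ x => legWeight δs ρ (anch υ) x with hϑ
  have hϑ0 : ∀ υ x, 0 ≤ ϑ υ x := fun υ x => (legWeight_pos δs ρ (anch υ) x).le
  have hϑle : ∀ υ x, legWeight δ' ρ (anch υ) x ≤ ϑ υ x := fun υ x => legWeight_anti (min_le_right _ _) hρ0 (anch υ) x
  have hΘ : ∀ σ : Fin (nn + 1) → Tor (fine (L ^ k) M),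
      (∏ ℓ, Real.exp (-(δs * (tdistT (fine (L ^ k) M) (σ (src ℓ)) (σ (tgt ℓ)) / (L : ℝ) ^ k)))) * ∏ υ, ϑ υ (σ (vtx υ))
        ≤ Real.exp (-(δs * treeLength ρ (anchors anch))) := fun σ =>
    prod_lineWeight_mul_prod_legWeight_le src tgt vtx anch hδs0 hρ0 hconn σ
  -- the stripped one-vertex majorants
  set p : Υ → Tor (fine (L ^ k) M) → ℝ := fun υ x => if υ = υ₀ then p₀ x else qq υ with hpdef
  have hp0' : ∀ υ x, 0 ≤ p υ x := fun υ x => by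
    by_cases h : υ = υ₀
    · subst h; simp only [hpdef, if_true]; exact hp₀0 x
    · simp only [hpdef, if_neg h]; exact hqq υ
  have hup : ∀ υ x, |u υ x| ≤ p υ x * ϑ υ x := fun υ x => by
    by_cases h : υ = υ₀
    · subst h; simp only [hpdef, if_true]; exact (hp₀ x).trans (mul_le_mul_of_nonneg_left (hϑle _ x) (hp₀0 x))
    · simp only [hpdef, if_neg h]; exact (hu υ h x).trans (mul_le_mul_of_nonneg_left (hϑle υ x) (hqq υ))
  have hpq : ∀ υ, υ ≠ υ₀ → ∀ x, p υ x ≤ qq υ := fun υ h x => by simp only [hpdef, if_neg h]; exact le_rfl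
  have hpΓ : ∑ x, (((L : ℝ) ^ k)⁻¹) ^ (d + 1) * p υ₀ x ≤ Γ := by simpa only [hpdef, if_true] using hΓ
  -- Kruskal's certificates, one per ordering
  have hex := fun π : Equiv.Perm (Fin m) => exists_certR_kruskal hconn π
  have key := H k eM hk M hM msq hm hcap nn m src tgt κ Υ vtx u ϑ p qq υ₀ Γ δs _ hυ₀ hϑ0 hp0' hup hpq hpΓ hδs0 (min_le_left _ _) hΘ
    (fun π => Classical.choose (hex π)) (fun π => by rw [orderList_eq_kingDegList _ _ π _ (Classical.choose_spec (hex π))]; exact hking π)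
  have hsum : ∑ π : Equiv.Perm (Fin m), degConst L (orderList ((d + 1 : ℕ) : ℝ) (fun ℓ => lineExp (d + 1) (κ ℓ)) π (Classical.choose (hex π)).F)
      = ∑ π : Equiv.Perm (Fin m), degConst L (kingDegList src tgt ((d + 1 : ℕ) : ℝ) (fun ℓ => lineExp (d + 1) (κ ℓ)) π) :=
    sum_congr rfl fun π _ => by rw [orderList_eq_kingDegList _ _ π _ (Classical.choose_spec (hex π))]
  rw [hsum] at key
  exact key

end Kruskal

end Summit.QuantumFields.YangMills.BalabanUVNodes.N15KingModelRung.Curved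

end
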